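import Mathlib.LinearAlgebra.Matrix.ToLin
import Mathlib.LinearAlgebra.Matrix.ToLinearEquiv
import Literature.NumberTheory.EllipticCurves.MazurTorsionGaloisStructureProofs
import Literature.NumberTheory.EllipticCurves.HeegnerPointsKolyvaginConjugation
import Literature.NumberTheory.GaloisRepresentations.CyclotomicLevels
import HarnessLib

/-!
# Non-Eisenstein witness, CORE: an element of `Gal(ℚ̄/ℚ(μ_N))` without fixed points on `E[p]`
# (`E[p]` irreducible, `p` odd, `p ∣ N`) — group theory on `E[p]`, PROVED

Cell `pub/bsd-wall` (D-0145 line `route-BirchSwinnertonDyer-EdixhovenFibreFiveSeven`), seat `bsd-line-edix-p5`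
(prover, width-5 attach). THEOREMS ONLY (no definition, no named fact, no `sorry`); route-free. First of two files:
the sibling `EdixhovenFibreFiveSevenNonEisensteinWitness.lean` turns the element produced here into a good prime
`ℓ ≡ 1 (mod M)` with `a_ℓ(E) ≢ ℓ + 1 (mod p)` by Chebotarev (the numeral `r₀` of the non-Eisenstein step of
L-TWIST, cruxes TDS57 stmt-BirchSwinnertonDyer-22227 / KP57 stmt-BirchSwinnertonDyer-23810 / AKR S57-T; Eisenstein
ideals in the sense of Darmon–Diamond–Taylor p. 120: "`T_r ≡ r + 1 mod 𝔫` for all `r ≡ 1 mod N`").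

**Lemma** (`exists_mem_rootsOfUnityFixer_forall_smul_ne`). For `E[p]` irreducible, `p` odd, `p ∣ N ≠ 0`, some
`σ ∈ H := Gal(ℚ̄/ℚ(μ_N))` (tree `rootsOfUnityFixer ℚ N`) has NO non-zero fixed point on `E[p]`. Proof.
`det ρ̄(σ) = χ̄_p(σ) = 1` on `H` (Weil pairing: tree `det_eq_modPCyclotomicCharacterZMod_of_exists_weilPairing` +
`exists_weilPairing_holds`; Cornell–Silverman–Stevens II §7). If every `σ ∈ H` had a fixed point, the common
fixed subgroup `E[p]^H` — `Γ_ℚ`-stable as `H ⊴ Γ_ℚ` — is `⊥` or `⊤` by irreducibility. (`⊤`) `Γ_ℚ` acts through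
the abelian quotient `Γ_ℚ/H` (`[Γ_ℚ, Γ_ℚ] ≤ H`, tree `commutator_le_rootsOfUnityFixer`), so the `+1`-eigenspace of
complex conjugation (both eigenlines non-zero: tree `RatClosure.exists_eigenvectors`) is `Γ_ℚ`-stable, `≠ ⊥, ⊤` —
reducible. (`⊥`) pick `σ₁ ∈ H` acting non-trivially with fixed point `P₁`; in a frame through `P₁`
(`exists_addEquiv_apply_eq_single`), `σ₁ = (1 b; 0 1)` with `b ≠ 0`; pick `σ₂ ∈ H` moving `P₁`; `σ₂` and `σ₁σ₂`
have a fixed point and determinant `1`, hence trace `2` (`det(M − 1) = det M − tr M + 1`); `tr(σ₁σ₂) = tr σ₂ +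
b·(σ₂)₁₀` forces `(σ₂)₁₀ = 0`, and then `det = 1`, `tr = 2` force `(σ₂)₀₀ = 1`: `σ₂` fixes `P₁` — contradiction.

Axioms: `propext`, `Classical.choice`, `Quot.sound`. BSD is not proved by this file.

References: [SilvermanCSS1997] Ch. II §7 Proposition, §8 (`det ρ̄ = χ`); [SilvermanAEC2009] III.8.1;
[Serre1972] §4; [DarmonDiamondTaylor1995] §4.3 p. 120.
-/

set_option autoImplicit false
-- the Theorems directory repeats the summit name (sibling precedent `SignedBaseChangeAssembly.lean`)
set_option linter.dupNamespace false

noncomputable section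

open scoped Classical commutatorElement

open WeierstrassCurve NumberField IsDedekindDomain Field
  Literature.NumberTheory.EllipticCurves Literature.NumberTheory.GaloisRepresentations

namespace Summit.BirchSwinnertonDyer.BirchSwinnertonDyer.Theorems.NonEisensteinWitness

/-! ### §1 Frames and matrices on `E[p]` -/

/-- **The matrix of `σ` in a frame of `E[p]`**: for an additive isomorphism `e : E[p] ≃ (ℤ/p)²` and
`σ ∈ Γ_ℚ` there is `M ∈ M₂(𝔽_p)` with `e (σ P) = M · e P` for all `P` (two `𝔽_p`-linear maps agreeing on the
standard basis; the construction of `MazurTorsionGaloisStructureProofs.smul_sub_cyclotomic_smul_mem_zmultiples`).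
[folklore] -/
theorem exists_matrix_frame (W : WeierstrassCurve ℚ) (p : ℕ) [Fact p.Prime]
    (e : geomTorsion W p ≃+ (Fin 2 → ZMod p)) (σ : absoluteGaloisGroup ℚ) :
    ∃ M : Matrix (Fin 2) (Fin 2) (ZMod p), ∀ T : geomTorsion W p, e (σ • T) = M.mulVec (e T) := by
  haveI : NeZero p := ⟨(Fact.out : p.Prime).ne_zero⟩
  set M : Matrix (Fin 2) (Fin 2) (ZMod p) :=
    Matrix.of fun i j ↦ e (σ • e.symm (Pi.single j 1)) i with hM
  refine ⟨M, ?_⟩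
  let f : (Fin 2 → ZMod p) →ₗ[ZMod p] (Fin 2 → ZMod p) :=
    (e.toAddMonoidHom.comp ((DistribSMul.toAddMonoidHom (geomTorsion W p) σ).comp
      e.symm.toAddMonoidHom)).toZModLinearMap p
  have hf : ∀ v, f v = e (σ • e.symm v) := fun _ ↦ rfl
  have hfg : f = Matrix.mulVecLin M := by
    refine (Pi.basisFun (ZMod p) (Fin 2)).ext fun j ↦ ?_
    rw [Pi.basisFun_apply, hf, Matrix.mulVecLin_apply, Matrix.mulVec_single_one]
    funext i
    rw [hM, Matrix.col_apply, Matrix.of_apply]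
  intro T
  have h := congrArg (fun g : (Fin 2 → ZMod p) →ₗ[ZMod p] (Fin 2 → ZMod p) ↦ g (e T)) hfg
  simp only [hf, Matrix.mulVecLin_apply, AddEquiv.symm_apply_apply] at h
  exact h

/-- A `2 × 2` matrix over a field with determinant `1` and a non-zero fixed vector has trace `2`
(`det(M − 1) = det M − tr M + 1 = 0`). [folklore] -/
theorem trace_eq_two_of_det_eq_one_of_mulVec_eq {p : ℕ} [Fact p.Prime] {M : Matrix (Fin 2) (Fin 2) (ZMod p)}
    (hdet : M.det = 1) {x : Fin 2 → ZMod p} (hx : x ≠ 0) (hMx : M.mulVec x = x) :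
    M 0 0 + M 1 1 = 2 := by
  have h0 : (M - 1).mulVec x = 0 := by rw [Matrix.sub_mulVec, hMx, Matrix.one_mulVec, sub_self]
  have hdet0 : (M - 1).det = 0 := (Matrix.exists_mulVec_eq_zero_iff).mp ⟨x, hx, h0⟩
  rw [Matrix.det_fin_two] at hdet hdet0
  simp only [Matrix.sub_apply, Matrix.one_apply_eq, Matrix.one_apply_ne (show (0 : Fin 2) ≠ 1 by decide),
    Matrix.one_apply_ne (show (1 : Fin 2) ≠ 0 by decide), sub_zero] at hdet0
  linear_combination hdet - hdet0

/-! ### §2 The group theory: an element of `Gal(ℚ̄/ℚ(μ_N))` without fixed points on `E[p]` -/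

/-- For `σ ∈ Gal(ℚ̄/ℚ(μ_N))` with `p ∣ N`: `χ̄_p(σ) = 1` (`μ_p ⊆ μ_N`; tree `rootsOfUnityFixer`). [folklore] -/
theorem modPCyclotomicCharacterZMod_eq_one_of_mem_rootsOfUnityFixer {p : ℕ} [Fact p.Prime] {N : ℕ}
    (hpN : p ∣ N) {σ : absoluteGaloisGroup ℚ} (hσ : σ ∈ rootsOfUnityFixer ℚ N) :
    modPCyclotomicCharacterZMod ℚ p σ = 1 := by
  haveI : NeZero p := ⟨(Fact.out : p.Prime).ne_zero⟩
  haveI : NeZero (p : ℚ) := NeZero.charZero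
  have hσp : σ ∈ rootsOfUnityFixer ℚ p := rootsOfUnityFixer_le_of_dvd ℚ hpN hσ
  rw [rootsOfUnityFixer_eq_ker, MonoidHom.mem_ker] at hσp
  rw [modPCyclotomicCharacterZMod_eq_modNCyclotomicCharacter]
  exact hσp

/-- **The determinant of `σ ∈ Gal(ℚ̄/ℚ(μ_N))` on `E[p]` is `1`** (`p ∣ N`): `det ρ̄_{E,p} = χ̄_p` by the Weil
pairing (tree `det_eq_modPCyclotomicCharacterZMod_of_exists_weilPairing`, `exists_weilPairing_holds`; Silverman in
Cornell–Silverman–Stevens II §7) and `χ̄_p = 1` on `Gal(ℚ̄/ℚ(μ_N))`.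
[cite: SilvermanCSS1997, Ch. II §7 Proposition and §8] -/
theorem det_eq_one_of_mem_rootsOfUnityFixer (W : WeierstrassCurve ℚ) [W.IsElliptic] (p : ℕ) [Fact p.Prime]
    {N : ℕ} (hpN : p ∣ N) (e : geomTorsion W p ≃+ (Fin 2 → ZMod p)) {σ : absoluteGaloisGroup ℚ}
    (hσ : σ ∈ rootsOfUnityFixer ℚ N) {M : Matrix (Fin 2) (Fin 2) (ZMod p)}
    (hM : ∀ T : geomTorsion W p, e (σ • T) = M.mulVec (e T)) : M.det = 1 := by
  haveI : NeZero p := ⟨(Fact.out : p.Prime).ne_zero⟩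
  haveI : NeZero (p : ℚ) := NeZero.charZero
  rw [det_eq_modPCyclotomicCharacterZMod_of_exists_weilPairing W p (exists_weilPairing_holds W p) e σ M hM,
    modPCyclotomicCharacterZMod_eq_one_of_mem_rootsOfUnityFixer hpN hσ, Units.val_one]

/-- **No common Eisenstein shape on `Gal(ℚ̄/ℚ(μ_N))`.** For `E[p]` irreducible, `p` odd and `p ∣ N`, some
`σ ∈ Gal(ℚ̄/ℚ(μ_N))` (i.e. `σ` fixing every `N`-th root of unity) has no non-zero fixed point on `E[p]`. See the
module docstring for the proof (`det = 1` on that subgroup by the Weil pairing; the common fixed subgroup is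
`Γ_ℚ`-stable; complex conjugation has both eigenlines; a `2 × 2` trace computation).
[cite: SilvermanCSS1997, Ch. II §7 Proposition and §8] [cite: Serre1972, §4] -/
theorem exists_mem_rootsOfUnityFixer_forall_smul_ne (W : WeierstrassCurve ℚ) [W.IsElliptic] (p : ℕ)
    [Fact p.Prime] (hp2 : p ≠ 2) (hirr : W.HasIrreducibleModPGaloisRep p) {N : ℕ} (hpN : p ∣ N)
    (hN : N ≠ 0) :
    ∃ σ : absoluteGaloisGroup ℚ, σ ∈ rootsOfUnityFixer ℚ N ∧
      ∀ P : geomTorsion W p, P ≠ 0 → σ • P ≠ P := by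
  have hp : p.Prime := Fact.out
  haveI : NeZero p := ⟨hp.ne_zero⟩
  haveI : NeZero N := ⟨hN⟩
  haveI : NeZero (N : ℚ) := NeZero.charZero
  haveI : NeZero (p : ℚ) := NeZero.charZero
  set H : Subgroup (absoluteGaloisGroup ℚ) := rootsOfUnityFixer ℚ N with hHdef
  have hHn : H.Normal := by
    rw [hHdef, rootsOfUnityFixer_eq_ker]
    exact MonoidHom.normal_ker _
  by_contra hcon
  push Not at hcon
  -- `hcon : ∀ σ ∈ H, ∃ P ≠ 0, σ • P = P`
  -- non-zero points of `E[p]` have order `p`; `-P ≠ P` for `P ≠ 0`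
  have hneg : ∀ P : geomTorsion W p, P ≠ 0 → -P ≠ P := by
    intro P hP0 h
    have h2 : 2 • P = 0 := by rw [two_nsmul]; nth_rw 1 [← h]; exact neg_add_cancel P
    have hdvd : addOrderOf P ∣ 2 := addOrderOf_dvd_of_nsmul_eq_zero h2
    rw [addOrderOf_eq_of_ne_zero W p hP0] at hdvd
    exact hp2 ((Nat.prime_dvd_prime_iff_eq hp Nat.prime_two).mp hdvd)
  -- the common fixed subgroup of `H`, a `Γ_ℚ`-stable subgroup
  let V0 : AddSubgroup (geomTorsion W p) :=
    { carrier := {P | ∀ σ ∈ H, σ • P = P}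
      add_mem' := fun {a b} ha hb σ hσ ↦ by rw [smul_add, ha σ hσ, hb σ hσ]
      zero_mem' := fun σ _ ↦ smul_zero σ
      neg_mem' := fun {a} ha σ hσ ↦ by rw [smul_neg, ha σ hσ] }
  have hV0mem : ∀ P, P ∈ V0 ↔ ∀ σ ∈ H, σ • P = P := fun P ↦ Iff.rfl
  have hV0stab : ∀ τ : absoluteGaloisGroup ℚ, ∀ P ∈ V0, τ • P ∈ V0 := by
    intro τ P hP σ hσ
    have hconj : τ⁻¹ * σ * τ ∈ H := by
      have := hHn.conj_mem σ hσ τ⁻¹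
      rwa [inv_inv] at this
    calc σ • τ • P = (τ * (τ⁻¹ * σ * τ)) • P := by rw [← mul_smul]; congr 1; group
      _ = τ • P := by rw [mul_smul, hP _ hconj]
  rcases hirr V0 hV0stab with hbot | htop
  · -- Case `V0 = ⊥`: a trace computation in a frame
    -- a non-trivial element `σ₁ ∈ H`
    have hcard : Nat.card (geomTorsion W p) = p ^ 2 := natCard_geomTorsion W p
    haveI : Finite (geomTorsion W p) :=
      Nat.finite_of_card_ne_zero (by rw [hcard]; exact pow_ne_zero 2 hp.ne_zero)
    have hnt : Nontrivial (geomTorsion W p) := by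
      rw [← Finite.one_lt_card_iff_nontrivial, hcard]
      exact Nat.one_lt_pow two_ne_zero hp.one_lt
    obtain ⟨T₀, hT₀⟩ := exists_ne (0 : geomTorsion W p)
    have hT₀V : T₀ ∉ V0 := by rw [hbot]; exact hT₀
    obtain ⟨σ₁, hσ₁H, hσ₁T⟩ : ∃ σ₁ ∈ H, σ₁ • T₀ ≠ T₀ := by
      by_contra h
      push Not at h
      exact hT₀V ((hV0mem T₀).mpr h)
    obtain ⟨P₁, hP₁0, hP₁⟩ := hcon σ₁ hσ₁H
    have hP₁V : P₁ ∉ V0 := by rw [hbot]; exact hP₁0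
    obtain ⟨σ₂, hσ₂H, hσ₂P⟩ : ∃ σ₂ ∈ H, σ₂ • P₁ ≠ P₁ := by
      by_contra h
      push Not at h
      exact hP₁V ((hV0mem P₁).mpr h)
    obtain ⟨P₂, hP₂0, hP₂⟩ := hcon σ₂ hσ₂H
    obtain ⟨P₃, hP₃0, hP₃⟩ := hcon (σ₁ * σ₂) (H.mul_mem hσ₁H hσ₂H)
    -- frame through `P₁` and the matrices
    obtain ⟨e, heP₁⟩ := exists_addEquiv_apply_eq_single W p hP₁0
    obtain ⟨M₁, hM₁⟩ := exists_matrix_frame W p e σ₁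
    obtain ⟨M₂, hM₂⟩ := exists_matrix_frame W p e σ₂
    have hM₁₂ : ∀ T : geomTorsion W p, e ((σ₁ * σ₂) • T) = (M₁ * M₂).mulVec (e T) := fun T ↦ by
      rw [mul_smul, hM₁, hM₂, Matrix.mulVec_mulVec]
    have hdet₁ := det_eq_one_of_mem_rootsOfUnityFixer W p hpN e hσ₁H hM₁
    have hdet₂ := det_eq_one_of_mem_rootsOfUnityFixer W p hpN e hσ₂H hM₂
    have hdet₁₂ := det_eq_one_of_mem_rootsOfUnityFixer W p hpN e (H.mul_mem hσ₁H hσ₂H) hM₁₂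
    have hex : ∀ P : geomTorsion W p, P ≠ 0 → e P ≠ 0 := fun P hP h ↦
      hP (e.injective (by rw [h, map_zero]))
    -- traces
    have htr₂ : M₂ 0 0 + M₂ 1 1 = 2 :=
      trace_eq_two_of_det_eq_one_of_mulVec_eq hdet₂ (hex P₂ hP₂0) (by rw [← hM₂, hP₂])
    have htr₁₂ : (M₁ * M₂) 0 0 + (M₁ * M₂) 1 1 = 2 :=
      trace_eq_two_of_det_eq_one_of_mulVec_eq hdet₁₂ (hex P₃ hP₃0) (by rw [← hM₁₂, hP₃])
    -- the first column of `M₁` is `e (σ₁ P₁) = e P₁ = (1, 0)`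
    have hcol₁ : ∀ i, M₁ i 0 = (Pi.single (0 : Fin 2) (1 : ZMod p) : Fin 2 → ZMod p) i := by
      intro i
      have h := hM₁ P₁
      rw [hP₁, heP₁, Matrix.mulVec_single_one] at h
      have := congrFun h i
      rw [Matrix.col_apply] at this
      exact this.symm
    have h00 : M₁ 0 0 = 1 := by rw [hcol₁]; simp
    have h10 : M₁ 1 0 = 0 := by rw [hcol₁]; simp
    have h11 : M₁ 1 1 = 1 := by
      rw [Matrix.det_fin_two, h00, h10, one_mul, mul_zero, sub_zero] at hdet₁
      exact hdet₁
    -- `M₁ ≠ 1`, so `b = M₁ 0 1 ≠ 0`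
    have hb : M₁ 0 1 ≠ 0 := by
      intro hb
      apply hσ₁T
      apply e.injective
      rw [hM₁]
      have hM1 : M₁ = 1 := by
        ext i j
        fin_cases i <;> fin_cases j
        · simpa using h00
        · simpa using hb
        · simpa using h10
        · simpa using h11
      rw [hM1, Matrix.one_mulVec]
    -- the first column of `M₂` is NOT `(1, 0)` (`σ₂` moves `P₁`)
    have hcol₂ : ¬ (M₂ 0 0 = 1 ∧ M₂ 1 0 = 0) := by
      rintro ⟨h1, h2⟩
      apply hσ₂P
      apply e.injective
      rw [hM₂, heP₁, Matrix.mulVec_single_one]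
      funext i
      rw [Matrix.col_apply]
      fin_cases i
      · simpa using h1
      · simpa using h2
    -- the trace of the product
    have hprod00 : (M₁ * M₂) 0 0 = M₂ 0 0 + M₁ 0 1 * M₂ 1 0 := by
      rw [Matrix.mul_apply, Fin.sum_univ_two, h00, one_mul]
    have hprod11 : (M₁ * M₂) 1 1 = M₂ 1 1 := by
      rw [Matrix.mul_apply, Fin.sum_univ_two, h10, h11, zero_mul, one_mul, zero_add]
    rw [hprod00, hprod11] at htr₁₂
    have h20 : M₁ 0 1 * M₂ 1 0 = 0 := by linear_combination htr₁₂ - htr₂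
    have hM₂10 : M₂ 1 0 = 0 := (mul_eq_zero.mp h20).resolve_left hb
    rw [Matrix.det_fin_two, hM₂10, mul_zero, sub_zero] at hdet₂
    have hsq : (M₂ 0 0 - 1) ^ 2 = 0 := by linear_combination (M₂ 0 0) * htr₂ - hdet₂
    have hM₂00 : M₂ 0 0 = 1 := by
      have := pow_eq_zero_iff (n := 2) two_ne_zero |>.mp hsq
      exact sub_eq_zero.mp this
    exact hcol₂ ⟨hM₂00, hM₂10⟩
  · -- Case `V0 = ⊤`: `H` acts trivially; complex conjugation splits `E[p]`
    have hfix : ∀ σ ∈ H, ∀ P : geomTorsion W p, σ • P = P := fun σ hσ P ↦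
      (hV0mem P).mp (by rw [htop]; exact AddSubgroup.mem_top P) σ hσ
    obtain ⟨c₀, hc₀⟩ := exists_isComplexConjugation (Rat.castHom ℝ)
    obtain ⟨⟨vPlus, hvPlus0, hvPlus⟩, ⟨vMinus, hvMinus0, hvMinus⟩⟩ :=
      RatClosure.exists_eigenvectors W hc₀ (exists_weilPairing_holds W p) hp2
    let A : AddSubgroup (geomTorsion W p) :=
      { carrier := {P | c₀ • P = P}
        add_mem' := fun {a b} ha hb ↦ by
          simp only [Set.mem_setOf_eq] at ha hb ⊢
          rw [smul_add, ha, hb]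
        zero_mem' := smul_zero c₀
        neg_mem' := fun {a} ha ↦ by
          simp only [Set.mem_setOf_eq] at ha ⊢
          rw [smul_neg, ha] }
    have hAmem : ∀ P, P ∈ A ↔ c₀ • P = P := fun P ↦ Iff.rfl
    have hAstab : ∀ τ : absoluteGaloisGroup ℚ, ∀ P ∈ A, τ • P ∈ A := by
      intro τ P hP
      rw [hAmem] at hP ⊢
      -- the commutator `κ = c₀⁻¹ τ⁻¹ c₀ τ` lies in `H ⊇ [Γ_ℚ, Γ_ℚ]` and acts trivially
      have hκ : ⁅c₀⁻¹, τ⁻¹⁆ ∈ H :=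
        commutator_le_rootsOfUnityFixer ℚ N (Subgroup.commutator_mem_commutator (Subgroup.mem_top _)
          (Subgroup.mem_top _))
      have hmul : c₀ * τ = τ * c₀ * ⁅c₀⁻¹, τ⁻¹⁆ := by rw [commutatorElement_def]; group
      calc c₀ • τ • P = (c₀ * τ) • P := (mul_smul _ _ _).symm
        _ = (τ * c₀ * ⁅c₀⁻¹, τ⁻¹⁆) • P := by rw [hmul]
        _ = τ • c₀ • (⁅c₀⁻¹, τ⁻¹⁆ • P) := by rw [mul_smul, mul_smul]
        _ = τ • P := by rw [hfix _ hκ P, hP]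
    rcases hirr A hAstab with hAbot | hAtop
    · have : vPlus ∈ A := (hAmem vPlus).mpr hvPlus
      rw [hAbot] at this
      exact hvPlus0 this
    · have : vMinus ∈ A := by rw [hAtop]; exact AddSubgroup.mem_top vMinus
      rw [hAmem, hvMinus] at this
      exact hneg vMinus hvMinus0 this

end Summit.BirchSwinnertonDyer.BirchSwinnertonDyer.Theorems.NonEisensteinWitness

end
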